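import Summits.Ventures.LatticeQCDFlow.Exactness.Phi4MetropolisSitePinskerFloor
import Summits.Ventures.LatticeQCDFlow.Exactness.Phi4MetropolisSiteMeanEnergyChange
import HarnessLib

/-!
# The site-Metropolis acceptance floor of lattice φ⁴ in the step law's moments:
# `⟨a_x⟩ ≥ 1 − √(1 − e^{−(m₂(J_xx + 6λ⟨φ_x²⟩) + λm₄)})` and `≥ 1 − √((m₂(J_xx + 6λ⟨φ_x²⟩) + λm₄)/2)` — UNCONDITIONAL

HONEST FRAMING: exact (Metropolis-corrected) sampling algorithms for lattice gauge theory;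
figures of merit are autocorrelation/cost numbers at stated couplings and volumes; no
continuum-physics claim.  (SCALAR calibration rung S0-A: not a gauge result.)

Venture `LatticeQCDFlow` (cell pub-lqcd), topic `Exactness`; FANOUT row 2 (`s0-phi4`, LOCAL arm).
NEW WORK of the cell — the composition of this generation's three local-arm files (nothing is cited
as a fact; no definition): `Phi4MetropolisSiteInvolution` (Bretagnolle–Huber floor from `⟨ΔS_x⟩`, the
first moment as HYPOTHESIS), `Phi4MetropolisSitePinskerFloor` (the Pinsker constant) and
`Phi4MetropolisSiteMeanEnergyChange` (the hypothesis DISCHARGED for every step law with moments and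
`⟨ΔS_x⟩ = m₂(J_xx + 6λ⟨φ_x²⟩) + λm₄` COMPUTED).  Result: for every `λ > 0`, real `J`, site `x` and
positive even step density `ρ` with `∫ ρ = 1` and all moments, with `Θ_x = m₂(J_xx + 6λ⟨φ_x²⟩) + λm₄`:

  `∫∫ min(1, e^{−ΔS_x}) ρ e^{−S} ≥ (1 − √(1 − e^{−Θ_x}))·Z`  and  `≥ (1 − √(Θ_x/2))·Z`;

for the window `U[−δ, δ]` (were it positive — it is not, so the window enters through the moment
form only): `Θ_x = (δ²/3)(J_xx + 6λ⟨φ_x²⟩) + λδ⁴/5`.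

## What is proved

* **`phi4MetropolisSite_acceptance_ge_moments`** (Bretagnolle–Huber form, unconditional);
* **`phi4MetropolisSite_acceptance_ge_pinsker_moments`** (Pinsker form, unconditional).

NOT CLAIMED: any value of `⟨φ_x²⟩`; step laws vanishing on a set (the window: the involution files ask
`ρ > 0`); the scan versions (immediate from the siblings' scan theorems, not restated); values.
-/

namespace Summit.Ventures.LatticeQCDFlow.Exactness

open Real MeasureTheory Filter Finset Set
open Summit.Ventures.LatticeQCDFlow.Scoring

variable {n : ℕ}

/-- **THE SITE ACCEPTANCE FLOOR IN THE STEP MOMENTS (Bretagnolle–Huber form)**: `λ > 0`, real `J`,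
`ρ > 0` even measurable with `∫ ρ = 1` and all moments, site `x`:
`∫∫ min(1, e^{−ΔS_x}) ρ e^{−S} ≥ (1 − √(1 − exp(−(m₂(J_xx + 6λ⟨φ_x²⟩) + λm₄))))·Z`. -/
theorem phi4MetropolisSite_acceptance_ge_moments {lam : ℝ} (hlam : 0 < lam)
    (J : Fin (n + 1) → Fin (n + 1) → ℝ) {ρ : ℝ → ℝ} (hρ0 : ∀ u, 0 < ρ u) (hρm : Measurable ρ)
    (hρs : ∀ u, ρ (-u) = ρ u) (hρ1 : ∫ u, ρ u = 1)
    (hmom : ∀ j : ℕ, Integrable (fun u => (1 + |u|) ^ j * ρ u)) (x : Fin (n + 1)) :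
    (1 - Real.sqrt (1 - Real.exp (-((∫ u, u ^ 2 * ρ u) * (J x x + 6 * lam * gibbsExpect J lam (fun φ => φ x ^ 2))
        + lam * ∫ u, u ^ 4 * ρ u)))) * gibbsZ J lam
      ≤ ∫ p, min 1 (Real.exp (-(latticePhi4Action J lam (p.2 + Pi.single x p.1)
          - latticePhi4Action J lam p.2))) * (gibbsWeight J lam p.2 * ρ p.1)
          ∂((volume : Measure ℝ).prod (volume : Measure (Fin (n + 1) → ℝ))) := by
  have hΔ := integrable_deltaS_site hlam J (fun u => (hρ0 u).le) hρm hmom x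
  have h := phi4MetropolisSite_acceptance_ge hlam J hρ0 hρm hρs hρ1 x hΔ
  rw [meanDeltaS_site_eq hlam J (fun u => (hρ0 u).le) hρm hρs hmom x] at h
  exact h

/-- **THE SITE ACCEPTANCE FLOOR IN THE STEP MOMENTS (Pinsker form)**: under the same hypotheses,
`∫∫ min(1, e^{−ΔS_x}) ρ e^{−S} ≥ (1 − √((m₂(J_xx + 6λ⟨φ_x²⟩) + λm₄)/2))·Z`. -/
theorem phi4MetropolisSite_acceptance_ge_pinsker_moments {lam : ℝ} (hlam : 0 < lam)
    (J : Fin (n + 1) → Fin (n + 1) → ℝ) {ρ : ℝ → ℝ} (hρ0 : ∀ u, 0 < ρ u) (hρm : Measurable ρ)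
    (hρs : ∀ u, ρ (-u) = ρ u) (hρ1 : ∫ u, ρ u = 1)
    (hmom : ∀ j : ℕ, Integrable (fun u => (1 + |u|) ^ j * ρ u)) (x : Fin (n + 1)) :
    (1 - Real.sqrt (((∫ u, u ^ 2 * ρ u) * (J x x + 6 * lam * gibbsExpect J lam (fun φ => φ x ^ 2))
        + lam * ∫ u, u ^ 4 * ρ u) / 2)) * gibbsZ J lam
      ≤ ∫ p, min 1 (Real.exp (-(latticePhi4Action J lam (p.2 + Pi.single x p.1)
          - latticePhi4Action J lam p.2))) * (gibbsWeight J lam p.2 * ρ p.1)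
          ∂((volume : Measure ℝ).prod (volume : Measure (Fin (n + 1) → ℝ))) := by
  have hΔ := integrable_deltaS_site hlam J (fun u => (hρ0 u).le) hρm hmom x
  have h := phi4MetropolisSite_acceptance_ge_pinsker hlam J hρ0 hρm hρs hρ1 x hΔ
  rw [meanDeltaS_site_eq hlam J (fun u => (hρ0 u).le) hρm hρs hmom x] at h
  exact h

end Summit.Ventures.LatticeQCDFlow.Exactness
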